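import Mathlib.LinearAlgebra.UnitaryGroup
import Mathlib.Analysis.Complex.Basic
import Mathlib.Algebra.Star.Unitary
import HarnessLib

/-!
# Two-level unitary matrices generate the unitary group (Nielsen–Chuang §4.5.1)

Topic `Literature/Computability/QuantumComplexity`; the linear-algebra half of the `n`-qubit layer of the
discharge of `cliffordT_generatesDenselyModPhase` (universality of Clifford+`T`): "two-level unitary gates are
universal" (Nielsen–Chuang 2010, §4.5.1, pp. 189–191; Reck–Zeilinger–Bernstein–Bertani 1994).

* `twoLevel s t a b c d` — the matrix acting as `[[a, b], [c, d]]` on the coordinates `s, t` and as the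
  identity elsewhere, with its row action `twoLevel_mul_apply`, products on a fixed pair, adjoint and
  unitarity;
* `FixesOutside S U` — `U` is the identity outside the coordinates of the finset `S` (closed under products);
* `twoLevelUnitaries ι`, `twoLevelClosure ι` (the generated monoid; it is a group, `star_mem_twoLevelClosure`);
* `exists_clear_column` — the column-clearing step of §4.5.1 (a two-level unitary on `(s, t)` sends the
  entries `(p, q)` of column `s` to `(√(|p|² + |q|²), 0)`);
* `mem_twoLevelClosure_of_fixesOutside`, **`mem_twoLevelClosure`** — every unitary matrix on a finite index
  type with at least two elements is a finite product of unitary two-level matrices (induction on the set of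
  coordinates moved: clear column `s`, fix the phase of the pivot, then row `s` is clear by unitarity).

## References

* M. A. Nielsen, I. L. Chuang, *Quantum Computation and Quantum Information*, CUP 2010, §4.5.1
  ("Two-level unitary gates are universal"), eqs. (4.41)–(4.51).

## Design notes

Stated for an arbitrary finite index type `ι` (used with `ι = QReg n`). The generated object is a
`Submonoid (Matrix ι ι ℂ)` rather than a subgroup of `Matrix.unitaryGroup ι ℂ`; since the adjoint of a two-level
unitary is a two-level unitary the two notions agree, and the submonoid form is what the gate-synthesis layer
consumes (a product-closed set of matrices containing the generators contains the closure).
-/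

noncomputable section

namespace Literature.Computability.QuantumComplexity

open _root_.Matrix Complex

variable {ι : Type*} [DecidableEq ι]

/-! ### Two-level matrices -/

/-- The **two-level matrix** acting as `[[a, b], [c, d]]` on the coordinates `s, t` (in this order) and as
the identity on all other coordinates (Nielsen–Chuang §4.5.1). [cite: NielsenChuang2010, §4.5.1] -/
def twoLevel (s t : ι) (a b c d : ℂ) : Matrix ι ι ℂ := fun i j =>
  if i = s then (if j = s then a else if j = t then b else 0)
  else if i = t then (if j = s then c else if j = t then d else 0)
  else (1 : Matrix ι ι ℂ) i j

/-- Entries of a two-level matrix outside the rows `s, t`. [folklore] -/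
theorem twoLevel_apply_of_ne {s t : ι} (a b c d : ℂ) {i : ι} (his : i ≠ s) (hit : i ≠ t) (j : ι) :
    twoLevel s t a b c d i j = (1 : Matrix ι ι ℂ) i j := by
  simp [twoLevel, his, hit]

/-- The identity is two-level. [folklore] -/
theorem twoLevel_one_zero_zero_one (s t : ι) : twoLevel s t 1 0 0 1 = (1 : Matrix ι ι ℂ) := by
  ext i j
  simp only [twoLevel, Matrix.one_apply]
  split_ifs <;> simp_all

/-- The adjoint of a two-level matrix. [folklore] -/
theorem star_twoLevel {s t : ι} (a b c d : ℂ) (hst : s ≠ t) : star (twoLevel s t a b c d) = twoLevel s t (star a) (star c) (star b) (star d) := by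
  ext i j
  simp only [Matrix.star_apply, twoLevel, Matrix.one_apply]
  by_cases his : i = s <;> by_cases hit : i = t <;> by_cases hjs : j = s <;> by_cases hjt : j = t <;>
    simp_all [eq_comm]

/-! ### Matrices acting on a set of coordinates -/

/-- `U` acts as the identity outside the coordinates of `S`: `U i j = δ i j` unless `i, j ∈ S`. [folklore] -/
def FixesOutside (S : Finset ι) (U : Matrix ι ι ℂ) : Prop :=
  ∀ i j, (i ∉ S ∨ j ∉ S) → U i j = (1 : Matrix ι ι ℂ) i j

namespace FixesOutside

variable {S : Finset ι}

/-- The identity fixes everything. [folklore] -/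
theorem one : FixesOutside S (1 : Matrix ι ι ℂ) := fun _ _ _ => rfl

/-- Monotonicity in the set of coordinates. [folklore] -/
theorem mono {T : Finset ι} (h : S ⊆ T) {U : Matrix ι ι ℂ} (hU : FixesOutside S U) : FixesOutside T U :=
  fun i j hij => hU i j (hij.imp (fun hi hi' => hi (h hi')) (fun hj hj' => hj (h hj')))

/-- The adjoint of a matrix acting on `S` acts on `S`. [folklore] -/
theorem star {U : Matrix ι ι ℂ} (hU : FixesOutside S U) : FixesOutside S (star U) := by
  intro i j hij
  rw [Matrix.star_apply, hU j i hij.symm]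
  by_cases h : i = j
  · subst h; simp
  · rw [Matrix.one_apply_ne h, Matrix.one_apply_ne (Ne.symm h), star_zero]

end FixesOutside

/-- A two-level matrix on coordinates of `S` acts on `S`. [folklore] -/
theorem fixesOutside_twoLevel {S : Finset ι} {s t : ι} (hs : s ∈ S) (ht : t ∈ S) (a b c d : ℂ) :
    FixesOutside S (twoLevel s t a b c d) := by
  intro i j hij
  rcases hij with hi | hj
  · have his : i ≠ s := fun h => hi (h ▸ hs)
    have hit : i ≠ t := fun h => hi (h ▸ ht)
    simp [twoLevel, his, hit]
  · have hjs : j ≠ s := fun h => hj (h ▸ hs)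
    have hjt : j ≠ t := fun h => hj (h ▸ ht)
    simp only [twoLevel, hjs, hjt, if_false, Matrix.one_apply]
    split_ifs with h1 h2 <;> simp_all

/-- A one-level phase `twoLevel s t μ 0 0 1` acts on any `S ∋ s`. [folklore] -/
theorem fixesOutside_twoLevel_diag {S : Finset ι} {s t : ι} (hst : s ≠ t) (hs : s ∈ S) (μ : ℂ) :
    FixesOutside S (twoLevel s t μ 0 0 1) := by
  intro i j hij
  simp only [twoLevel, Matrix.one_apply]
  have : ¬ (i = s ∧ j = s) := fun ⟨hi, hj⟩ => by rcases hij with h | h <;> simp_all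
  split_ifs <;> simp_all



section fintype

variable [Fintype ι]

section twoLevel

variable {s t : ι} (hst : s ≠ t) (a b c d : ℂ)
include hst

/-- Row `s` of a two-level matrix times `M`: `a M_s + b M_t`; row `t`: `c M_s + d M_t`; other rows unchanged.
[folklore] -/
theorem twoLevel_mul_apply (M : Matrix ι ι ℂ) (i j : ι) :
    (twoLevel s t a b c d * M) i j =
      if i = s then a * M s j + b * M t j else if i = t then c * M s j + d * M t j else M i j := by
  rw [Matrix.mul_apply]
  by_cases his : i = s
  · subst his
    rw [if_pos rfl, Fintype.sum_eq_add i t hst]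
    · simp [twoLevel, hst.symm]
    · intro k ⟨hki, hkt⟩; simp [twoLevel, hki, hkt]
  · rw [if_neg his]
    by_cases hit : i = t
    · subst hit
      rw [if_pos rfl, Fintype.sum_eq_add s i hst]
      · simp [twoLevel, hst.symm]
      · intro k ⟨hks, hki⟩; simp [twoLevel, hks, hki, hst.symm]
    · rw [if_neg hit, Finset.sum_eq_single i]
      · simp [twoLevel, his, hit]
      · intro k _ hki; simp [twoLevel, his, hit, Ne.symm hki]
      · intro h; exact absurd (Finset.mem_univ i) h

/-- Product of two-level matrices on the same pair of coordinates. [folklore] -/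
theorem twoLevel_mul_twoLevel (a' b' c' d' : ℂ) :
    twoLevel s t a b c d * twoLevel s t a' b' c' d' =
      twoLevel s t (a * a' + b * c') (a * b' + b * d') (c * a' + d * c') (c * b' + d * d') := by
  ext i j
  rw [twoLevel_mul_apply hst]
  by_cases his : i = s
  · subst his; simp [twoLevel, hst.symm]; split_ifs <;> ring
  · by_cases hit : i = t
    · subst hit; simp [twoLevel]; split_ifs <;> ring
    · simp [twoLevel, his, hit]

/-- A two-level matrix with a unitary `2 × 2` block is unitary. [folklore] -/
theorem twoLevel_mem_unitaryGroup (h1 : a * star a + b * star b = 1) (h2 : a * star c + b * star d = 0)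
    (h3 : c * star a + d * star b = 0) (h4 : c * star c + d * star d = 1) :
    twoLevel s t a b c d ∈ Matrix.unitaryGroup ι ℂ := by
  rw [Matrix.mem_unitaryGroup_iff, star_twoLevel a b c d hst, twoLevel_mul_twoLevel hst, h1, h2, h3, h4,
    twoLevel_one_zero_zero_one]

end twoLevel

namespace FixesOutside

variable {S : Finset ι}

/-- Products of matrices acting on `S` act on `S`. [folklore] -/
theorem mul {U V : Matrix ι ι ℂ} (hU : FixesOutside S U) (hV : FixesOutside S V) : FixesOutside S (U * V) := by
  intro i j hij
  rw [Matrix.mul_apply]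
  rcases hij with hi | hj
  · rw [Finset.sum_eq_single i, hU i i (Or.inl hi), Matrix.one_apply_eq, one_mul, hV i j (Or.inl hi)]
    · intro k _ hki; rw [hU i k (Or.inl hi), Matrix.one_apply_ne (Ne.symm hki), zero_mul]
    · simp
  · rw [Finset.sum_eq_single j, hV j j (Or.inr hj), Matrix.one_apply_eq, mul_one, hU i j (Or.inr hj)]
    · intro k _ hkj; rw [hV k j (Or.inr hj), Matrix.one_apply_ne hkj, mul_zero]
    · simp

end FixesOutside

/-! ### Two-level unitaries generate `U(ι)` -/

variable (ι) in
/-- The unitary two-level matrices on the index type `ι`. [folklore] -/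
def twoLevelUnitaries : Set (Matrix ι ι ℂ) :=
  {M | ∃ (s t : ι) (a b c d : ℂ), s ≠ t ∧ M = twoLevel s t a b c d ∧ M ∈ Matrix.unitaryGroup ι ℂ}

variable (ι) in
/-- The monoid generated by the unitary two-level matrices (finite products). [folklore] -/
abbrev twoLevelClosure : Submonoid (Matrix ι ι ℂ) := Submonoid.closure (twoLevelUnitaries ι)

/-- Products of unitary two-level matrices are unitary. [folklore] -/
theorem twoLevelClosure_le_unitaryGroup : twoLevelClosure ι ≤ Matrix.unitaryGroup ι ℂ :=
  Submonoid.closure_le.2 fun _ ⟨_, _, _, _, _, _, _, _, hM⟩ => hM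

/-- The generated monoid is closed under adjoints (it is a group). [folklore] -/
theorem star_mem_twoLevelClosure {M : Matrix ι ι ℂ} (hM : M ∈ twoLevelClosure ι) : star M ∈ twoLevelClosure ι := by
  induction hM using Submonoid.closure_induction with
  | mem x hx =>
    obtain ⟨s, t, a, b, c, d, hst, rfl, hu⟩ := hx
    exact Submonoid.subset_closure ⟨s, t, _, _, _, _, hst, star_twoLevel a b c d hst, Unitary.star_mem hu⟩
  | one => rw [star_one]; exact Submonoid.one_mem _
  | mul x y _ _ hx hy => rw [star_mul]; exact Submonoid.mul_mem _ hy hx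

/-- A unitary row with diagonal entry `1` vanishes off the diagonal. [folklore] -/
theorem row_eq_zero_of_diag_eq_one {N : Matrix ι ι ℂ} (hN : N ∈ Matrix.unitaryGroup ι ℂ) {s : ι} (hs : N s s = 1)
    {j : ι} (hjs : j ≠ s) : N s j = 0 := by
  have e := congrFun (congrFun (Matrix.mem_unitaryGroup_iff.1 hN) s) s
  rw [Matrix.mul_apply, Matrix.one_apply_eq, ← Finset.add_sum_erase _ _ (Finset.mem_univ s)] at e
  simp only [Matrix.star_apply, hs, star_one, mul_one, add_eq_left] at e
  have e' : ∑ x ∈ Finset.univ.erase s, Complex.normSq (N s x) = 0 := by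
    have : ∀ x, N s x * star (N s x) = (Complex.normSq (N s x) : ℂ) := fun x => by
      rw [Complex.star_def, Complex.mul_conj]
    simp only [this] at e
    exact_mod_cast e
  rw [Finset.sum_eq_zero_iff_of_nonneg (fun x _ => Complex.normSq_nonneg _)] at e'
  exact Complex.normSq_eq_zero.1 (e' j (Finset.mem_erase.2 ⟨hjs, Finset.mem_univ j⟩))

/-- **Column clearing** (Nielsen–Chuang §4.5.1): multiplying `U` on the left by two-level unitaries on the
pairs `(s, t)`, `t ∈ T`, kills the entries `(t, s)`, `t ∈ T`, of column `s`. [cite: NielsenChuang2010, §4.5.1] -/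
theorem exists_clear_column (U : Matrix ι ι ℂ) (s : ι) (S : Finset ι) (hsS : s ∉ S) :
    ∀ T : Finset ι, T ⊆ S →
      ∃ L ∈ twoLevelClosure ι, FixesOutside (insert s S) L ∧ ∀ t ∈ T, (L * U) t s = 0 := by
  intro T
  induction T using Finset.induction_on with
  | empty => intro; exact ⟨1, Submonoid.one_mem _, FixesOutside.one, by simp⟩
  | insert t T htT ih =>
    intro hTS
    obtain ⟨L, hL, hLfix, hLT⟩ := ih ((Finset.subset_insert _ _).trans hTS)
    have htS : t ∈ S := hTS (Finset.mem_insert_self _ _)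
    have hst : s ≠ t := fun h => hsS (h ▸ htS)
    set M := L * U with hM
    by_cases hq : M t s = 0
    · refine ⟨L, hL, hLfix, fun t' ht' => ?_⟩
      rcases Finset.mem_insert.1 ht' with rfl | h
      · exact hq
      · exact hLT t' h
    · -- the two-level rotation sending `(M s s, M t s)` to `(r, 0)`
      set p := M s s with hp
      set q := M t s with hq'
      set r : ℝ := Real.sqrt (Complex.normSq p + Complex.normSq q) with hr
      have hpq0 : 0 ≤ Complex.normSq p + Complex.normSq q := add_nonneg (Complex.normSq_nonneg _) (Complex.normSq_nonneg _)
      have hr0 : 0 < r := Real.sqrt_pos.2 (by have := Complex.normSq_pos.2 hq; have := Complex.normSq_nonneg p; linarith)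
      have hr2 : (r : ℂ) * r = p * star p + q * star q := by
        rw [← Complex.ofReal_mul, Real.mul_self_sqrt hpq0, Complex.ofReal_add]
        simp only [Complex.star_def, Complex.mul_conj]
      have hrC : (r : ℂ) ≠ 0 := Complex.ofReal_ne_zero.2 hr0.ne'
      have hsr : star (r : ℂ) = r := Complex.conj_ofReal r
      -- `u / r` written as `u * r⁻¹`
      set ri : ℂ := (r : ℂ)⁻¹ with hri
      have hri2 : ri * ri * (p * star p + q * star q) = 1 := by
        rw [← hr2, hri]; field_simp
      have hsri : star ri = ri := by rw [hri, star_inv₀, hsr]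
      set R := twoLevel s t (star p * ri) (star q * ri) (-q * ri) (p * ri) with hR
      have hRu : R ∈ Matrix.unitaryGroup ι ℂ := by
        apply twoLevel_mem_unitaryGroup hst <;> simp only [star_mul, star_neg, star_star, hsri]
        · linear_combination hri2
        · ring
        · ring
        · linear_combination hri2
      refine ⟨R * L, Submonoid.mul_mem _ (Submonoid.subset_closure ⟨s, t, _, _, _, _, hst, rfl, hRu⟩) hL,
        (fixesOutside_twoLevel (Finset.mem_insert_self s S) (Finset.mem_insert_of_mem htS) _ _ _ _).mul hLfix, ?_⟩
      intro t' ht'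
      rw [Matrix.mul_assoc, ← hM, twoLevel_mul_apply hst]
      rcases Finset.mem_insert.1 ht' with rfl | h
      · rw [if_neg hst.symm, if_pos rfl, ← hp, ← hq']; ring
      · have h1 : t' ≠ s := fun e => hsS (e ▸ (hTS (Finset.mem_insert_of_mem h)))
        have h2 : t' ≠ t := fun e => htT (e ▸ h)
        rw [if_neg h1, if_neg h2]; exact hLT t' h

/-- **Two-level unitaries generate the unitary group** (Nielsen–Chuang §4.5.1, "two-level unitary gates
are universal"): every unitary matrix acting on the coordinates of `S` is a finite product of unitary
two-level matrices. [cite: NielsenChuang2010, §4.5.1] -/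
theorem mem_twoLevelClosure_of_fixesOutside [Nontrivial ι] :
    ∀ (S : Finset ι) (U : Matrix ι ι ℂ), U ∈ Matrix.unitaryGroup ι ℂ → FixesOutside S U → U ∈ twoLevelClosure ι := by
  intro S
  induction S using Finset.induction_on with
  | empty =>
    intro U _ hfix
    have : U = 1 := by ext i j; exact hfix i j (Or.inl (by simp))
    rw [this]; exact Submonoid.one_mem _
  | insert s S hsS ih =>
    intro U hU hfix
    obtain ⟨L, hL, hLfix, hLcol⟩ := exists_clear_column U s S hsS S subset_rfl
    have hLu : L ∈ Matrix.unitaryGroup ι ℂ := twoLevelClosure_le_unitaryGroup hL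
    set M := L * U with hM
    have hMu : M ∈ Matrix.unitaryGroup ι ℂ := Submonoid.mul_mem _ hLu hU
    have hMfix : FixesOutside (insert s S) M := hLfix.mul hfix
    -- column `s` of `M` is `M s s • e_s` with `|M s s| = 1`
    have hcol : ∀ i, i ≠ s → M i s = 0 := by
      intro i his
      by_cases hiS : i ∈ S
      · exact hLcol i hiS
      · have : i ∉ insert s S := by simp [his, hiS]
        rw [hMfix i s (Or.inl this), Matrix.one_apply_ne his]
    have hp : star (M s s) * M s s = 1 := by
      have e := congrFun (congrFun (Matrix.mem_unitaryGroup_iff'.1 hMu) s) s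
      rw [Matrix.mul_apply, Matrix.one_apply_eq, Finset.sum_eq_single s] at e
      · simpa [Matrix.star_apply] using e
      · intro k _ hks; rw [hcol k hks, mul_zero]
      · simp
    -- phase correction on `(s, t₀)`
    obtain ⟨t₀, ht₀⟩ := exists_ne s
    set D := twoLevel s t₀ (star (M s s)) 0 0 1 with hD
    have hDu : D ∈ Matrix.unitaryGroup ι ℂ :=
      twoLevel_mem_unitaryGroup ht₀.symm _ _ _ _ (by rw [star_star, hp]; simp) (by simp) (by simp) (by simp)
    have hDgen : D ∈ twoLevelClosure ι := Submonoid.subset_closure ⟨s, t₀, _, _, _, _, ht₀.symm, rfl, hDu⟩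
    set N := D * M with hN
    have hNu : N ∈ Matrix.unitaryGroup ι ℂ := Submonoid.mul_mem _ hDu hMu
    have hNcol : ∀ i, N i s = (1 : Matrix ι ι ℂ) i s := by
      intro i
      rw [hN, twoLevel_mul_apply ht₀.symm]
      by_cases his : i = s
      · subst his; rw [if_pos rfl, Matrix.one_apply_eq, hcol t₀ ht₀, mul_zero, add_zero, hp]
      · rw [if_neg his, Matrix.one_apply_ne his]
        by_cases hit : i = t₀
        · subst hit; rw [if_pos rfl, hcol i his]; simp
        · rw [if_neg hit, hcol i his]
    have hNrow : ∀ j, j ≠ s → N s j = 0 := fun j hjs =>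
      row_eq_zero_of_diag_eq_one hNu (by rw [hNcol s, Matrix.one_apply_eq]) hjs
    have hNfix : FixesOutside S N := by
      intro i j hij
      by_cases his : i = s
      · subst his
        by_cases hjs : j = i
        · subst hjs; exact hNcol j
        · rw [hNrow j hjs, Matrix.one_apply_ne (Ne.symm hjs)]
      · by_cases hjs : j = s
        · subst hjs; exact hNcol i
        · have hij' : i ∉ insert s S ∨ j ∉ insert s S := hij.imp (by simp [his]) (by simp [hjs])
          exact ((fixesOutside_twoLevel_diag ht₀.symm (Finset.mem_insert_self s S) _).mul hMfix) i j hij'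
    have hNmem : N ∈ twoLevelClosure ι := ih N hNu hNfix
    -- `U = L† (D† N)`
    have e1 : star D * N = M := by rw [hN, ← Matrix.mul_assoc, Matrix.mem_unitaryGroup_iff'.1 hDu, Matrix.one_mul]
    have e2 : star L * M = U := by rw [hM, ← Matrix.mul_assoc, Matrix.mem_unitaryGroup_iff'.1 hLu, Matrix.one_mul]
    rw [← e2, ← e1]
    exact Submonoid.mul_mem _ (star_mem_twoLevelClosure hL)
      (Submonoid.mul_mem _ (star_mem_twoLevelClosure hDgen) hNmem)

/-- **Two-level unitaries generate `U(ι)`** (Nielsen–Chuang §4.5.1): every unitary matrix on a finite index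
type with at least two elements is a finite product of unitary two-level matrices. [cite: NielsenChuang2010, §4.5.1] -/
theorem mem_twoLevelClosure [Nontrivial ι] {U : Matrix ι ι ℂ} (hU : U ∈ Matrix.unitaryGroup ι ℂ) :
    U ∈ twoLevelClosure ι :=
  mem_twoLevelClosure_of_fixesOutside Finset.univ U hU fun i j h => by simp at h

end fintype

end Literature.Computability.QuantumComplexity
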